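import Summits.FinalStateConjecture.FinalStateConjecture.Theorems.SwallowTheDatumSubdataDevelopmentsEmbedSkeleton2
import Summits.FinalStateConjecture.FinalStateConjecture.Theorems.SwallowTheDatumSubdataDevelopmentsEmbedHcauchy

/-!
# Route SwallowTheDatum · item `SubdataDevelopmentsEmbed` (stmt-FinalStateConjecture-10053) —
# the item from the named fact of local geometric uniqueness and the relative
# "no corresponding boundary points" theorem ALONE

`subdataDevelopmentsEmbed_of_locallyUnique_of_cauchyRegion_of_ncb` (`…Skeleton2.lean`) reduced
the item to the registered Literature statement `hawkingEllis_locallyUnique_vacuumDevelopment`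
(Hawking–Ellis 1973, §7.5; Sbierski 2016, Thm. 2.4 (ii)) and two displayed causal inputs:
(b) `hc`, the domain of dependence of the sub-datum, and (c) `hncb`, the relative "no
corresponding boundary points" theorem. Input (b) is now a theorem of the tree, `hcauchy_holds`
(`…Hcauchy.lean`, over `…DoD{Causal,Cone,Extend,Tilt,Endpoint,Assembly,Local,Main,Tangent}.lean`).
Composing: **the item follows from the named PDE fact and `hncb` alone**
(`subdataDevelopmentsEmbed_of_locallyUnique_of_ncb`). This is a CONDITIONAL result (hypothesis
`h` is the named Literature fact); `hncb` — a relative common sub-development of a development of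
the sub-datum and a MAXIMAL development of the datum admitting no proper extension has no
corresponding boundary points (Sbierski 2016, Thm. 3.5 = arXiv Thm. 12, relative form; its
printed proof is the causal theory of §3.2 plus one more application of local uniqueness across a
spacelike piece of `∂U`) — is the one remaining displayed hypothesis of the item.

Pure composition; no definition; no new named fact.
-/

noncomputable section

open Function Set Filter Topology TopologicalSpace
open scoped Manifold ContDiff Topology

namespace Summit.FinalStateConjecture.FinalStateConjecture.Theorems

namespace SubdataDevelopmentsEmbed

open Literature.Geometry.Lorentzian

/-- **`SubdataDevelopmentsEmbed` from the named fact of local geometric uniqueness and the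
relative "no corresponding boundary points" theorem alone**:
`subdataDevelopmentsEmbed_of_locallyUnique_of_cauchyRegion_of_ncb` with its causal input (b)
discharged by `hcauchy_holds`. [cite: HawkingEllis1973CUP, §7.5, pp. 248–249 and §7.6, p. 250]
[cite: Sbierski2016AHP, Thm. 3.5 and §3.3] -/
theorem subdataDevelopmentsEmbed_of_locallyUnique_of_ncb
    (h : hawkingEllis_locallyUnique_vacuumDevelopment)
    (hncb : ∀ (X : Type) [TopologicalSpace X] [ChartedSpace E3 X] [IsManifold (𝓡 3) ∞ X]
      [T2Space X] [SecondCountableTopology X] [ConnectedSpace X] (D : InitialDataSet (𝓡 3) X)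
      (𝒟 : VacuumCauchyDevelopment D), 𝒟.IsMaximal →
      ∀ (N : Type) [TopologicalSpace N] [ChartedSpace E3 N] [IsManifold (𝓡 3) ∞ N]
      [ConnectedSpace N] (Φ : N → X) (hΦ : ContMDiff (𝓡 3) (𝓡 3) (∞ + 1) Φ)
      (hΦ' : ∀ u, Injective (mfderiv (𝓡 3) (𝓡 3) Φ u)), IsOpenEmbedding Φ →
      ∀ (𝒟' : VacuumCauchyDevelopment (D.comap Φ hΦ hΦ')) (U : Opens 𝒟'.carrier)
        (ψ : 𝒟'.carrier → 𝒟.carrier),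
        ((∀ u, 𝒟'.embed u ∈ U) ∧ IsConnected (U : Set 𝒟'.carrier) ∧
        (𝒟'.metric.restrict PseudoRiemannianMetric.contMDiff_restrict_holds U).IsCauchyHypersurface
          (𝒟'.timeOrientation.restrict PseudoRiemannianMetric.contMDiff_restrict_holds
            𝒟'.timeOrientation.contMDiff_restrict_holds U) (Subtype.val ⁻¹' range 𝒟'.embed) ∧
        ContMDiffOn (𝓡 4) (𝓡 4) ∞ ψ U ∧
        (∀ p ∈ U, pullbackBilin (I := 𝓡 4) (I' := 𝓡 4) ψ 𝒟.metric.val p = 𝒟'.metric.val p) ∧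
        (∀ p ∈ U, 𝒟.timeOrientation.IsFutureDirected
          (mfderiv (𝓡 4) (𝓡 4) ψ p (𝒟'.timeOrientation.vectorField p))) ∧
        ψ ∘ 𝒟'.embed = 𝒟.embed ∘ Φ) →
        (∀ (U' : Opens 𝒟'.carrier) (ψ' : 𝒟'.carrier → 𝒟.carrier),
          ((∀ u, 𝒟'.embed u ∈ U') ∧ IsConnected (U' : Set 𝒟'.carrier) ∧
          (𝒟'.metric.restrict PseudoRiemannianMetric.contMDiff_restrict_holds
              U').IsCauchyHypersurface
            (𝒟'.timeOrientation.restrict PseudoRiemannianMetric.contMDiff_restrict_holds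
              𝒟'.timeOrientation.contMDiff_restrict_holds U') (Subtype.val ⁻¹' range 𝒟'.embed) ∧
          ContMDiffOn (𝓡 4) (𝓡 4) ∞ ψ' U' ∧
          (∀ p ∈ U', pullbackBilin (I := 𝓡 4) (I' := 𝓡 4) ψ' 𝒟.metric.val p = 𝒟'.metric.val p) ∧
          (∀ p ∈ U', 𝒟.timeOrientation.IsFutureDirected
            (mfderiv (𝓡 4) (𝓡 4) ψ' p (𝒟'.timeOrientation.vectorField p))) ∧
          ψ' ∘ 𝒟'.embed = 𝒟.embed ∘ Φ) →
          U ≤ U' → EqOn ψ ψ' U → U' = U) →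
        ∀ p ∈ frontier (U : Set 𝒟'.carrier), ∀ q : 𝒟.carrier,
          ¬ ClusterPt q (map ψ (𝓝[(U : Set 𝒟'.carrier)] p))) :
    Summit.FinalStateConjecture.FinalStateConjecture.Theses.SwallowTheDatum.SubdataDevelopmentsEmbed :=
  subdataDevelopmentsEmbed_of_locallyUnique_of_cauchyRegion_of_ncb h
    (fun X _ _ _ _ _ _ D 𝒟 N _ _ _ _ Φ hΦ hΦ' hΦo ↦ hcauchy_holds X D 𝒟 N Φ hΦ hΦ' hΦo) hncb

end SubdataDevelopmentsEmbed

end Summit.FinalStateConjecture.FinalStateConjecture.Theorems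

end
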